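import Literature.NumberTheory.Sieve.LargestPrimeFactorCubicSmoothSum
import Literature.NumberTheory.Sieve.LargestPrimeFactorCubicProofs
import HarnessLib

/-!
# Heath-Brown 2001, Lemma 2.2 (the Chebyshev–Hooley step) — IV: the lemma and the reduction of Theorem 1

Topic `Literature/NumberTheory/Sieve`; last file of the proof of the lemma of D. R. Heath-Brown,
*The largest prime factor of `X³ + 2`*, Proc. London Math. Soc. (3) 82 (2001) 554–596, restated
as Lemma 2.2 of A. J. Irving, arXiv:1412.0024 = Acta Arith. 171 (2015), p. 4 (quoted in
`LargestPrimeFactorCubicLocal`).  Everything here is PROVED; no named facts.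

In rational language (Irving's Lemma 2.1: the prime ideals of `ℤ[∛2]` dividing `n + ∛2` are of
degree one with distinct norms and `N(n + ∛2) = n³ + 2`, so that
`log^{(1)}(n³+2) = ∑_{p ≤ 3X} v_p(n³+2) log p` and "a prime ideal factor of norm `≥ Y`" is
"a prime factor `≥ Y`"):

* `card_largePrime_ge_of_card_smoothLog_ge` — **Lemma 2.2 with an explicit rate**: for
  `α, δ > 0` there is `C` such that for every `X ≥ 2`, if at least `αX` of the `n ∈ (X, 2X]`
  have `log^{(1)}(n³+2) ≥ (1+δ) log X`, then at least `δα²X − C X/log X` of them have a prime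
  factor `p ≥ X^{1+αδ/2}` of `n³ + 2`;
* `card_largePrime_eventually_ge` — the printed form: under the hypothesis for all large `X`,
  the count is `≥ (δα² − ε)X` for all large `X`, every `ε > 0` ("`(δα² + o(1))X`");
* `HeathBrown2001_largestPrimeFactor_cubic_of_card_smoothLog_ge`,
  `Irving2015_largestPrimeFactor_cubic_of_card_smoothLog_ge` — the two named facts of
  `LargestPrimeFactorCubic` REDUCED to their sieve-theoretic core (Irving's Lemma 2.3 with the
  divisor construction `J = KL`, resp. Irving's §§3–5): a positive proportion `α` of
  `n ∈ (X, 2X]` with `log^{(1)}(n³+2) ≥ (1 + δ) log X` and `αδ/2 > 10⁻³⁰³` resp. `> 10⁻⁵²`.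

Heath-Brown's own statement (the paper is held since 2026-08-15, `lit read doi:10.1112/plms/82.3.554`,
p. 559): "**Lemma 2.** Let `α` and `δ` be positive constants. Suppose that we have a set `𝒜^{(1)}`
of integers `n + ∛2` as above [`log^{(1)}(n³+2) ≥ (1+δ) log X` for `n ∈ 𝒜^{(1)}`, p. 558], with
`#𝒜^{(1)} ≥ αX`. Then the number of integers `n ∈ (X, 2X]` for which `n³ + 2` has a prime factor
`p ≥ X^{1+δα/2}` is at least `(δα² + o(1))X`."  His proof (pp. 558–559: `X₁(1+δ) + X₂(1−δ') ≤
X + O(X/log X)` by the Prime Ideal Theorem, `δ' = δX₁/X`, at most two prime ideals of norm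
`> 3X`) is the one formalised here; the endgame of Theorem 1 (p. 565: "`δ = 1/321` … we may
choose `α = 10⁻³⁰⁰ < 9.2 × 10⁻⁸ × (1/321) 2⁻⁹⁶³` … Theorem 1 then follows from Lemma 2, with
`ϖ = 10⁻³⁰³ < δα/2`") is `HeathBrown2001_largestPrimeFactor_cubic_of_printed_constants` below;
what it leaves is Heath-Brown's Lemma 3 input `#𝒜^{(1)} ≥ 10⁻³⁰⁰ X` for `δ = 1/321`
(Lemmas 3–9, §§3–8, and Theorem 2, §9 — the `q`-analogue of van der Corput's method).

The proof is the Chebyshev–Hooley accounting: `∑_n log(n³+2) ≥ 3X log X`,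
`∑_n log^{(1)} ≤ X log X + KX` (`…SmoothSum`, prime ideal theorem), so
`∑_n log^{(2)} ≥ 2X log X − KX`; pointwise `log^{(2)} ≤ (2−δ) log X + log 9` on the good set,
`≤ 2(1 + αδ/2) log X` off the set `𝓑` of `n` with a prime factor `≥ X^{1+αδ/2}` (at most two
prime factors `> 3X`, `…Local`), `≤ 3 log X + log 9` always; comparing,
`#𝓑 · log X ≥ α²δ X log X − (K + log 9) X` — the choice `2η = αδ` of the exponent makes the
constant exactly Heath-Brown's `δα²`.

## NOTE — displaced declarations to re-append (race of 2026-08-15, p46793 vs p46856)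

Two seats proved this lemma independently within the same hour and both targeted THIS path:
p46856 (seat `…Sieve.Irving2015-f31bb12a88-0`, namespace `Literature.NumberTheory.Sieve.Irving2015`,
building on `LargestPrimeFactorCubicSmallPart.exists_sum_smallPart_le`) was applied first and
p46793 (this content) afterwards, which DISPLACED the ten declarations of p46856 (gate note:
"removes 10 declaration(s) nothing references"):
`Irving2015.accounting`, `Irving2015.heathBrown_lemma_2_2`, `Irving2015.log_cube_add_two_bounds`,
`Irving2015.log_eq_sum_primeFactors`, `Irving2015.log_sub_smallPart_eq`,
`Irving2015.log_sub_smallPart_le_two_mul_log`, `Irving2015.smallPart_eq_sum_primeFactors`,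
`Irving2015.smallPart_le_log`, `Irving2015.smallPart_nonneg` and
`Literature.NumberTheory.Sieve.Irving2015_largestPrimeFactor_cubic_of_inputs`.
They are NOT superseded or refuted — their source is not recoverable from this hub (no proposal
fetch verb, tree history protected), so the owning seat should RE-APPEND them to this file
verbatim (append protocol; the two developments coexist, different namespaces).  Until then the
same mathematics is available here as
`LargestPrimeFactorCubic.card_largePrime_ge_of_card_smoothLog_ge` /
`LargestPrimeFactorCubic.card_largePrime_eventually_ge` (Lemma 2.2, hypothesis
`α X ≤ #{n ∈ Ioc X (2X) | (1+δ) log X ≤ ∑_{p ∈ primesLE (3X)} v_p(n³+2) log p}`, i.e. exactly the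
`smallPart` sum of `LargestPrimeFactorCubicSmallPart`) and
`LargestPrimeFactorCubic.Irving2015_largestPrimeFactor_cubic_of_card_smoothLog_ge`
(the named fact from that hypothesis with `αδ/2 > 10⁻⁵²`).

## References

* D. R. Heath-Brown, Proc. London Math. Soc. (3) 82 (2001) 554–596, Thm. 1 and its Lemmas.
  [`HeathBrown2001LargestPrimeFactorCubic`]
* A. J. Irving, arXiv:1412.0024 (Acta Arith. 171 (2015) 67–80), p. 3, §2 Lemmas 2.1–2.3, §5.
  [`Irving2014LargestPrimeFactorCubic`]
-/

noncomputable section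

open Finset Real Filter

namespace Literature.NumberTheory.Sieve.LargestPrimeFactorCubic

open scoped Classical in
/-- **Heath-Brown 2001, Lemma (= Irving 2015, Lemma 2.2), with an explicit rate.**  For
`α, δ > 0` there is `C` such that for all `X ≥ 2`: if at least `αX` integers `n ∈ (X, 2X]`
satisfy `log^{(1)}(n³+2) = ∑_{p ≤ 3X} v_p(n³+2) log p ≥ (1+δ) log X`, then at least
`δα² X − C X/log X` integers `n ∈ (X, 2X]` have a prime factor `p ∣ n³ + 2` with `p ≥ X^{1+αδ/2}`.
(Printed: "… is then at least `(δα² + o(1))X`".)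
[cite: Irving2014LargestPrimeFactorCubic, Lemma 2.2] [cite: HeathBrown2001LargestPrimeFactorCubic, Lemma 2 (§2, p. 559)] -/
theorem card_largePrime_ge_of_card_smoothLog_ge {α δ : ℝ} (hα : 0 < α) (hδ : 0 < δ) :
    ∃ C : ℝ, ∀ X : ℕ, 2 ≤ X →
      α * X ≤ #{n ∈ Ioc X (2 * X) | (1 + δ) * Real.log X ≤
          ∑ p ∈ Nat.primesLE (3 * X), ((n ^ 3 + 2).factorization p : ℝ) * Real.log p} →
      δ * α ^ 2 * X - C * X / Real.log X ≤
        #{n ∈ Ioc X (2 * X) | ∃ p : ℕ, p.Prime ∧ p ∣ n ^ 3 + 2 ∧ (X : ℝ) ^ (1 + α * δ / 2) ≤ p} := by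
  obtain ⟨K, hK⟩ := sum_smoothLog_le
  refine ⟨K + Real.log 9, fun X hX hG => ?_⟩
  -- notation
  set A := Ioc X (2 * X) with hA
  set ℓ := Real.log X with hℓ
  set η := α * δ / 2 with hη
  set L : ℕ → ℝ := fun n => Real.log ((n ^ 3 + 2 : ℕ) : ℝ) with hL
  set L1 : ℕ → ℝ := fun n =>
    ∑ p ∈ Nat.primesLE (3 * X), ((n ^ 3 + 2).factorization p : ℝ) * Real.log p with hL1
  set PG : ℕ → Prop := fun n => (1 + δ) * ℓ ≤ L1 n with hPG
  set PB : ℕ → Prop := fun n =>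
    ∃ p : ℕ, p.Prime ∧ p ∣ n ^ 3 + 2 ∧ (X : ℝ) ^ (1 + η) ≤ p with hPB
  have hX1 : (1 : ℝ) < X := by exact_mod_cast (show 1 < X by omega)
  have hX0 : (0 : ℝ) < X := by linarith
  have hℓ0 : 0 < ℓ := Real.log_pos hX1
  have hη0 : 0 ≤ η := by positivity
  have hc9 : 0 ≤ Real.log 9 := Real.log_nonneg (by norm_num)
  have hcardA : (#A : ℝ) = X := by
    rw [hA, Nat.card_Ioc, show 2 * X - X = X by omega]
  -- (S1) `∑ L ≥ 3 ℓ X`, (S2) `∑ L1 ≤ X ℓ + K X`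
  have hS1 : 3 * ℓ * X ≤ ∑ n ∈ A, L n := by
    calc 3 * ℓ * X = #A • (3 * ℓ) := by rw [nsmul_eq_mul, hcardA]; ring
      _ ≤ ∑ n ∈ A, L n := card_nsmul_le_sum _ _ _ fun n hn => (log_cube_add_two_bounds hX hn).1
  have hS2 : ∑ n ∈ A, L1 n ≤ X * ℓ + K * X := hK X hX
  -- pointwise bounds on `L2 = L − L1`
  have hP1 : ∀ n ∈ A.filter PG, L n - L1 n ≤ (2 - δ) * ℓ + Real.log 9 := by
    intro n hn
    rw [mem_filter] at hn
    have h := (log_cube_add_two_bounds hX hn.1).2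
    have hg : (1 + δ) * ℓ ≤ L1 n := hn.2
    simp only [hL] at h ⊢
    linarith
  have hP2 : ∀ n ∈ (A.filter fun n => ¬ PG n).filter (fun n => ¬ PB n),
      L n - L1 n ≤ 2 * ((1 + η) * ℓ) := by
    intro n hn
    simp only [mem_filter] at hn
    obtain ⟨⟨hnA, -⟩, hnB⟩ := hn
    have hZ : (1 : ℝ) ≤ (X : ℝ) ^ (1 + η) := Real.one_le_rpow hX1.le (by linarith)
    have hnoZ : ∀ p : ℕ, p.Prime → p ∣ n ^ 3 + 2 → (p : ℝ) < (X : ℝ) ^ (1 + η) := by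
      intro p hp hpd
      by_contra hle
      exact hnB ⟨p, hp, hpd, not_lt.1 hle⟩
    have h := log_sub_smoothLog_le_of_no_large_prime hnA hZ hnoZ
    rw [Real.log_rpow hX0] at h
    exact h
  have hP3 : ∀ n ∈ (A.filter fun n => ¬ PG n).filter PB, L n - L1 n ≤ 3 * ℓ + Real.log 9 := by
    intro n hn
    simp only [mem_filter] at hn
    have h := (log_cube_add_two_bounds hX hn.1.1).2
    have h0 := smoothLog_nonneg X n
    simp only [hL, hL1] at h h0 ⊢
    linarith
  -- the partition of `∑ (L − L1)`
  have hsplit : ∑ n ∈ A, (L n - L1 n) =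
      ∑ n ∈ A.filter PG, (L n - L1 n) +
        (∑ n ∈ (A.filter fun n => ¬ PG n).filter PB, (L n - L1 n) +
          ∑ n ∈ (A.filter fun n => ¬ PG n).filter (fun n => ¬ PB n), (L n - L1 n)) := by
    rw [← sum_filter_add_sum_filter_not A PG,
      ← sum_filter_add_sum_filter_not (A.filter fun n => ¬ PG n) PB]
  set g : ℝ := ((#(A.filter PG) : ℕ) : ℝ) with hg
  set b : ℝ := ((#((A.filter fun n => ¬ PG n).filter PB) : ℕ) : ℝ) with hb
  set r : ℝ := ((#((A.filter fun n => ¬ PG n).filter (fun n => ¬ PB n)) : ℕ) : ℝ) with hr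
  have hgbr : g + (b + r) = X := by
    rw [hg, hb, hr, ← hcardA, ← card_filter_add_card_filter_not (s := A) PG,
      ← card_filter_add_card_filter_not (s := A.filter fun n => ¬ PG n) PB]
    push_cast
    ring
  have hg0 : 0 ≤ g := Nat.cast_nonneg _
  have hb0 : 0 ≤ b := Nat.cast_nonneg _
  have hr0 : 0 ≤ r := Nat.cast_nonneg _
  have hbB : b ≤ #(A.filter PB) := by
    rw [hb]
    exact_mod_cast card_le_card (fun n hn => by
      simp only [mem_filter] at hn ⊢
      exact ⟨hn.1.1, hn.2⟩)
  -- the three partial sums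
  have hT1 : ∑ n ∈ A.filter PG, (L n - L1 n) ≤ g * ((2 - δ) * ℓ + Real.log 9) := by
    rw [hg, ← nsmul_eq_mul]; exact sum_le_card_nsmul _ _ _ hP1
  have hT2 : ∑ n ∈ (A.filter fun n => ¬ PG n).filter PB, (L n - L1 n) ≤
      b * (3 * ℓ + Real.log 9) := by
    rw [hb, ← nsmul_eq_mul]; exact sum_le_card_nsmul _ _ _ hP3
  have hT3 : ∑ n ∈ (A.filter fun n => ¬ PG n).filter (fun n => ¬ PB n), (L n - L1 n) ≤
      r * (2 * ((1 + η) * ℓ)) := by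
    rw [hr, ← nsmul_eq_mul]; exact sum_le_card_nsmul _ _ _ hP2
  -- the accounting
  have hsum : ∑ n ∈ A, (L n - L1 n) = ∑ n ∈ A, L n - ∑ n ∈ A, L1 n := sum_sub_distrib _ _
  have hmain : 2 * X * ℓ - K * X ≤
      g * ((2 - δ) * ℓ + Real.log 9) + b * (3 * ℓ + Real.log 9) + r * (2 * ((1 + η) * ℓ)) := by
    have := hsplit ▸ hsum
    linarith
  have hG' : α * X ≤ g := hG
  have hP5 : (δ + α * δ) * ℓ * (α * X) ≤ (δ + α * δ) * ℓ * g :=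
    mul_le_mul_of_nonneg_left hG' (by positivity)
  have hP6 : 0 ≤ α * δ * (b * ℓ) := by positivity
  have hkey : (δ * α ^ 2 * X - b) * ℓ ≤ (K + Real.log 9) * X := by
    have hr' : r = X - g - b := by linarith
    rw [hr', hη] at hmain
    nlinarith [hmain, hP5, hP6, hg0, hb0, hr0, hℓ0, hc9, hgbr]
  have hfin : δ * α ^ 2 * X - (K + Real.log 9) * X / ℓ ≤ b := by
    rw [sub_le_comm, le_div_iff₀ hℓ0]
    linarith
  exact hfin.trans hbB

open scoped Classical in
/-- **Heath-Brown 2001, Lemma (= Irving 2015, Lemma 2.2), printed form.**  Let `α, δ > 0` and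
suppose that for all sufficiently large `X` at least `αX` of the `n ∈ (X, 2X]` satisfy
`∑_{p ≤ 3X} v_p(n³+2) log p ≥ (1+δ) log X`.  Then for every `ε > 0` and all sufficiently large
`X`, at least `(δα² − ε)X` of the `n ∈ (X, 2X]` have a prime factor `p ∣ n³+2`,
`p ≥ X^{1+αδ/2}` ("at least `(δα² + o(1))X`").
[cite: Irving2014LargestPrimeFactorCubic, Lemma 2.2] [cite: HeathBrown2001LargestPrimeFactorCubic, Lemma 2 (§2, p. 559)] -/
theorem card_largePrime_eventually_ge {α δ : ℝ} (hα : 0 < α) (hδ : 0 < δ)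
    (h : ∀ᶠ X : ℕ in atTop, α * X ≤ #{n ∈ Ioc X (2 * X) | (1 + δ) * Real.log X ≤
          ∑ p ∈ Nat.primesLE (3 * X), ((n ^ 3 + 2).factorization p : ℝ) * Real.log p})
    {ε : ℝ} (hε : 0 < ε) :
    ∀ᶠ X : ℕ in atTop, (δ * α ^ 2 - ε) * X ≤
      #{n ∈ Ioc X (2 * X) | ∃ p : ℕ, p.Prime ∧ p ∣ n ^ 3 + 2 ∧ (X : ℝ) ^ (1 + α * δ / 2) ≤ p} := by
  obtain ⟨C, hC⟩ := card_largePrime_ge_of_card_smoothLog_ge hα hδ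
  have hlog : Tendsto (fun X : ℕ => Real.log X) atTop atTop :=
    Real.tendsto_log_atTop.comp tendsto_natCast_atTop_atTop
  filter_upwards [h, eventually_ge_atTop 2, hlog.eventually_ge_atTop (|C| / ε)] with X hG hX hlogX
  have hX0 : (0 : ℝ) < X := by exact_mod_cast (show 0 < X by omega)
  have hℓ0 : 0 < Real.log X := Real.log_pos (by exact_mod_cast (show 1 < X by omega))
  have h1 := hC X hX hG
  have h2 : C * X / Real.log X ≤ ε * X := by
    rw [div_le_iff₀ hℓ0]
    have : |C| ≤ ε * Real.log X := by rwa [div_le_iff₀ hε, mul_comm] at hlogX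
    nlinarith [le_abs_self C, this, hX0]
  linarith

/-! ### The two named facts, reduced to their sieve-theoretic core -/

open scoped Classical in
/-- The shape of Lemma 2.2's output implies `HeathBrown2001_largestPrimeFactor_cubic`: a count
of `≥ cX` integers `n ∈ (X, 2X]` with a prime factor `p ≥ X^{1+ϖ'}` of `n³ + 2`, for some
`ϖ' > 10⁻³⁰³` and all large `X`, gives the named fact (strict inequality at the exponent
`10⁻³⁰³`, `X > 1`). [cite: Irving2014LargestPrimeFactorCubic, p. 3 (restatement of Heath-Brown's Thm. 1)] -/
theorem HeathBrown2001_largestPrimeFactor_cubic_of_count_ge {ϖ' c : ℝ}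
    (hϖ : (1 : ℝ) / 10 ^ 303 < ϖ') (hc : 0 < c)
    (h : ∀ᶠ X : ℕ in atTop, c * X ≤
      (((Ioc X (2 * X)).filter fun n =>
          ∃ p : ℕ, p.Prime ∧ p ∣ n ^ 3 + 2 ∧ (X : ℝ) ^ (1 + ϖ') ≤ p).card : ℝ)) :
    HeathBrown2001_largestPrimeFactor_cubic := by
  refine ⟨c, hc, ?_⟩
  filter_upwards [h, eventually_gt_atTop 1] with X hX h1
  refine hX.trans ?_
  have hle : ((Ioc X (2 * X)).filter fun n =>
        ∃ p : ℕ, p.Prime ∧ p ∣ n ^ 3 + 2 ∧ (X : ℝ) ^ (1 + ϖ') ≤ p).card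
      ≤ cubicLargePrimeFactorCount (1 / 10 ^ 303) X := by
    unfold cubicLargePrimeFactorCount
    refine card_le_card (fun n hn => ?_)
    simp only [mem_filter] at hn ⊢
    obtain ⟨hn, p, hp, hdvd, hle⟩ := hn
    refine ⟨hn, p, hp, hdvd, lt_of_lt_of_le ?_ hle⟩
    have hX1 : (1 : ℝ) < X := by exact_mod_cast h1
    exact Real.rpow_lt_rpow_of_exponent_lt hX1 (by gcongr)
  exact_mod_cast hle

open scoped Classical in
/-- **Heath-Brown 2001, Theorem 1 reduced to its sieve core by Lemma 2.2**: if for some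
`α, δ > 0` with `αδ/2 > 10⁻³⁰³` and all sufficiently large `X` at least `αX` of the `n ∈ (X, 2X]`
satisfy `∑_{p ≤ 3X} v_p(n³+2) log p ≥ (1+δ) log X` (Heath-Brown: `δ = 1/321` and the
sieve-weighted count of divisors `KL ∣ n + ∛2` with `X^{1+δ} < N(KL) ≤ X^{1+2δ}`, his Theorem 2),
then `HeathBrown2001_largestPrimeFactor_cubic` holds.
[cite: Irving2014LargestPrimeFactorCubic, §2 (Lemmas 2.2–2.3)] [cite: HeathBrown2001LargestPrimeFactorCubic, §2, Lemmas 2–3 and p. 565 (Thm. 1 from Lemma 2)] -/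
theorem HeathBrown2001_largestPrimeFactor_cubic_of_card_smoothLog_ge {α δ : ℝ} (hα : 0 < α)
    (hδ : 0 < δ) (hϖ : (1 : ℝ) / 10 ^ 303 < α * δ / 2)
    (h : ∀ᶠ X : ℕ in atTop, α * X ≤ #{n ∈ Ioc X (2 * X) | (1 + δ) * Real.log X ≤
          ∑ p ∈ Nat.primesLE (3 * X), ((n ^ 3 + 2).factorization p : ℝ) * Real.log p}) :
    HeathBrown2001_largestPrimeFactor_cubic := by
  have hε : 0 < δ * α ^ 2 / 2 := by positivity
  refine HeathBrown2001_largestPrimeFactor_cubic_of_count_ge hϖ hε ?_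
  filter_upwards [card_largePrime_eventually_ge hα hδ h hε] with X hX
  have : (δ * α ^ 2 - δ * α ^ 2 / 2) * (X : ℝ) = δ * α ^ 2 / 2 * X := by ring
  rw [this] at hX
  exact hX

open scoped Classical in
/-- **Irving 2015, Theorem 1.1 reduced to its sieve core by Lemma 2.2**: if for some
`α, δ > 0` with `αδ/2 > 10⁻⁵²` and all sufficiently large `X` at least `αX` of the `n ∈ (X, 2X]`
satisfy `∑_{p ≤ 3X} v_p(n³+2) log p ≥ (1+δ) log X` (Irving, §5: `δ = 1/321`,
`α = 7.7·10⁻⁵⁰` from Lemma 2.3 and the bounds for `T(h, δ)`), then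
`Irving2015_largestPrimeFactor_cubic` holds. [cite: Irving2014LargestPrimeFactorCubic, §5 and Lemma 2.2] -/
theorem Irving2015_largestPrimeFactor_cubic_of_card_smoothLog_ge {α δ : ℝ} (hα : 0 < α)
    (hδ : 0 < δ) (hϖ : (1 : ℝ) / 10 ^ 52 < α * δ / 2)
    (h : ∀ᶠ X : ℕ in atTop, α * X ≤ #{n ∈ Ioc X (2 * X) | (1 + δ) * Real.log X ≤
          ∑ p ∈ Nat.primesLE (3 * X), ((n ^ 3 + 2).factorization p : ℝ) * Real.log p}) :
    Irving2015_largestPrimeFactor_cubic := by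
  have hε : 0 < δ * α ^ 2 / 2 := by positivity
  refine Irving2015_largestPrimeFactor_cubic_of_count_ge hϖ hε ?_
  filter_upwards [card_largePrime_eventually_ge hα hδ h hε] with X hX
  have : (δ * α ^ 2 - δ * α ^ 2 / 2) * (X : ℝ) = δ * α ^ 2 / 2 * X := by ring
  rw [this] at hX
  exact hX

/-- **Heath-Brown's numerical endgame** (p. 565): with `δ = 1/321` and `α = 10⁻³⁰⁰` one has
`ϖ = 10⁻³⁰³ < δα/2` (indeed `δα/2 = 1/(642·10³⁰⁰)` and `642 < 10³`).
[cite: HeathBrown2001LargestPrimeFactorCubic, p. 565] -/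
theorem printed_exponent_lt : (1 : ℝ) / 10 ^ 303 < 1 / 10 ^ 300 * (1 / 321) / 2 := by
  have h300 : (0 : ℝ) < 10 ^ 300 := by positivity
  have hpow : (10 : ℝ) ^ 303 = 10 ^ 3 * 10 ^ 300 := by rw [← pow_add]
  have h3 : (10 : ℝ) ^ 3 = 1000 := by norm_num
  rw [hpow, h3, show (1 : ℝ) / 10 ^ 300 * (1 / 321) / 2 = 1 / (642 * 10 ^ 300) by
    field_simp; ring]
  exact one_div_lt_one_div_of_lt (by positivity) (mul_lt_mul_of_pos_right (by norm_num) h300)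

open scoped Classical in
/-- **Heath-Brown 2001, Theorem 1 from his Lemma 2 with the printed constants** (p. 565:
"If we now choose `δ = 1/321` … According to Lemma 3 we may choose `α = 10⁻³⁰⁰` … Theorem 1
then follows from Lemma 2, with `ϖ = 10⁻³⁰³ < δα/2`"): if for all sufficiently large `X` at
least `10⁻³⁰⁰ X` of the `n ∈ (X, 2X]` satisfy `log^{(1)}(n³+2) = ∑_{p ≤ 3X} v_p(n³+2) log p ≥
(1 + 1/321) log X` (the content of his Lemmas 3–9 and Theorem 2), then
`HeathBrown2001_largestPrimeFactor_cubic` holds.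
[cite: HeathBrown2001LargestPrimeFactorCubic, p. 565 and Lemma 2] -/
theorem HeathBrown2001_largestPrimeFactor_cubic_of_printed_constants
    (h : ∀ᶠ X : ℕ in atTop, (1 : ℝ) / 10 ^ 300 * X ≤
      #{n ∈ Ioc X (2 * X) | (1 + (1 : ℝ) / 321) * Real.log X ≤
          ∑ p ∈ Nat.primesLE (3 * X), ((n ^ 3 + 2).factorization p : ℝ) * Real.log p}) :
    HeathBrown2001_largestPrimeFactor_cubic :=
  HeathBrown2001_largestPrimeFactor_cubic_of_card_smoothLog_ge (α := 1 / 10 ^ 300) (δ := 1 / 321)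
    (by positivity) (by positivity) printed_exponent_lt h

/-! ### Heath-Brown's construction of `𝒜^{(1)}` through divisors (p. 560) -/

/-- **A smooth divisor bounds `log^{(1)}` from below** (Heath-Brown, p. 560: "Since any factor `P`
of `J` must divide either `K` or `L`, it follows that `N(P) ≤ X`. Thus
`log^{(1)}(n³+2) ≥ ∑_{I ∣ J} Λ(I) = log N(J) ≥ (1+δ) log X`"), rational form: if `d ∣ n³ + 2`
(`X < n ≤ 2X`) and every prime factor of `d` is `≤ 3X`, then `log d ≤ ∑_{p ≤ 3X} v_p(n³+2) log p`.
[cite: HeathBrown2001LargestPrimeFactorCubic, §2 p. 560] -/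
theorem log_le_smoothLog_of_dvd {X n d : ℕ} (hd : d ∣ n ^ 3 + 2)
    (hsmooth : ∀ p : ℕ, p.Prime → p ∣ d → p ≤ 3 * X) :
    Real.log d ≤ ∑ p ∈ Nat.primesLE (3 * X), ((n ^ 3 + 2).factorization p : ℝ) * Real.log p := by
  have hm0 : n ^ 3 + 2 ≠ 0 := by positivity
  have hd0 : d ≠ 0 := ne_zero_of_dvd_ne_zero hm0 hd
  have hsub : d.primeFactors ⊆ Nat.primesLE (3 * X) := fun p hp =>
    Nat.mem_primesLE.2 ⟨hsmooth p (Nat.prime_of_mem_primeFactors hp)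
      (Nat.dvd_of_mem_primeFactors hp), Nat.prime_of_mem_primeFactors hp⟩
  have h1 : Real.log d = ∑ p ∈ d.primeFactors, (d.factorization p : ℝ) * Real.log p :=
    log_eq_sum_primeFactors d
  have h2 : ∑ p ∈ d.primeFactors, (d.factorization p : ℝ) * Real.log p ≤
      ∑ p ∈ d.primeFactors, ((n ^ 3 + 2).factorization p : ℝ) * Real.log p := by
    refine sum_le_sum fun p hp => ?_
    refine mul_le_mul_of_nonneg_right ?_
      (Real.log_nonneg (by exact_mod_cast (Nat.prime_of_mem_primeFactors hp).one_lt.le))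
    exact_mod_cast (Nat.factorization_le_iff_dvd hd0 hm0).2 hd p
  have h3 : ∑ p ∈ d.primeFactors, ((n ^ 3 + 2).factorization p : ℝ) * Real.log p ≤
      ∑ p ∈ Nat.primesLE (3 * X), ((n ^ 3 + 2).factorization p : ℝ) * Real.log p :=
    sum_le_sum_of_subset_of_nonneg hsub fun p hp _ =>
      mul_nonneg (Nat.cast_nonneg _)
        (Real.log_nonneg (by exact_mod_cast (Nat.mem_primesLE.1 hp).2.one_lt.le))
  exact h1.le.trans (h2.trans h3)

open scoped Classical in
/-- **Heath-Brown's `𝒜^{(1)}` via divisors** (p. 560): the `n ∈ (X, 2X]` such that `n³ + 2` has a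
divisor `d > X^{1+δ}` all of whose prime factors are `≤ 3X` (for him `d = N(KL)`,
`X^{1+δ} < N(KL) ≤ X^{1+2δ}`, `N(K) ≤ X^{4δ}`, `N(L) ≤ X^{1−δ}`) lie in
`𝒜^{(1)} = {n : log^{(1)}(n³+2) ≥ (1+δ) log X}`; hence a count of the former is a count of the
latter. [cite: HeathBrown2001LargestPrimeFactorCubic, §2 p. 560] -/
theorem card_divisor_le_card_smoothLog (X : ℕ) (δ : ℝ) :
    #{n ∈ Ioc X (2 * X) | ∃ d : ℕ, d ∣ n ^ 3 + 2 ∧ (X : ℝ) ^ (1 + δ) < d ∧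
        ∀ p : ℕ, p.Prime → p ∣ d → p ≤ 3 * X} ≤
      #{n ∈ Ioc X (2 * X) | (1 + δ) * Real.log X ≤
        ∑ p ∈ Nat.primesLE (3 * X), ((n ^ 3 + 2).factorization p : ℝ) * Real.log p} := by
  refine card_le_card fun n hn => ?_
  simp only [mem_filter] at hn ⊢
  obtain ⟨hnA, d, hd, hXd, hsmooth⟩ := hn
  refine ⟨hnA, ?_⟩
  have hX0 : (0 : ℝ) < X := by
    have : 0 < X := by rw [mem_Ioc] at hnA; omega
    exact_mod_cast this
  have hd0 : (0 : ℝ) < d := lt_of_le_of_lt (by positivity) hXd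
  calc (1 + δ) * Real.log X = Real.log ((X : ℝ) ^ (1 + δ)) := (Real.log_rpow hX0 _).symm
    _ ≤ Real.log d := Real.log_le_log (by positivity) hXd.le
    _ ≤ _ := log_le_smoothLog_of_dvd hd hsmooth

open scoped Classical in
/-- **Heath-Brown 2001, Theorem 1 reduced to his divisor count** (pp. 560–565): if for all
sufficiently large `X` at least `10⁻³⁰⁰ X` of the `n ∈ (X, 2X]` admit a divisor `d ∣ n³ + 2` with
`d > X^{1+1/321}` and all prime factors of `d` at most `3X` (Heath-Brown produces them as
`d = N(KL)` counted by the sieved sum `S = X S₀ + S₁`, Lemmas 3–9 and Theorem 2), then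
`HeathBrown2001_largestPrimeFactor_cubic` holds.
[cite: HeathBrown2001LargestPrimeFactorCubic, §2 pp. 560–565] -/
theorem HeathBrown2001_largestPrimeFactor_cubic_of_card_divisor_ge
    (h : ∀ᶠ X : ℕ in atTop, (1 : ℝ) / 10 ^ 300 * X ≤
      #{n ∈ Ioc X (2 * X) | ∃ d : ℕ, d ∣ n ^ 3 + 2 ∧ (X : ℝ) ^ (1 + (1 : ℝ) / 321) < d ∧
        ∀ p : ℕ, p.Prime → p ∣ d → p ≤ 3 * X}) :
    HeathBrown2001_largestPrimeFactor_cubic := by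
  refine HeathBrown2001_largestPrimeFactor_cubic_of_printed_constants ?_
  filter_upwards [h] with X hX
  exact hX.trans (by exact_mod_cast card_divisor_le_card_smoothLog X ((1 : ℝ) / 321))

end Literature.NumberTheory.Sieve.LargestPrimeFactorCubic
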